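import Summits.BirchSwinnertonDyer.BirchSwinnertonDyer.Theses.PlecticLegs
import Summits.Langlands.Langlands.Theses.AdjointEulerNumerical
import Literature.NumberTheory.EllipticCurves.Selmer
import Literature.NumberTheory.EllipticCurves.GaloisAction
import Literature.NumberTheory.EllipticCurves.SelmerCorankHolds
import Literature.NumberTheory.EllipticCurves.AnalyticRank
import Literature.NumberTheory.EllipticCurves.SelmerFirstZeroTotallyReal
import Literature.NumberTheory.EllipticCurves.SelmerParityTotallyReal
import Literature.NumberTheory.EllipticCurves.ComplexMultiplicationDeuringOrdinarySplit
import Literature.NumberTheory.Automorphic.TotallyRealModularity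
import Literature.NumberTheory.Automorphic.AutomorphicEllipticCurveEntireLFunction
import Summits.BirchSwinnertonDyer.BirchSwinnertonDyer.Theorems.PlecticLegsPlecticPointsLBStubFirstZeroPlectic
import Summits.BirchSwinnertonDyer.BirchSwinnertonDyer.Theorems.PlecticLegsPlecticPointsLBStubParityOrdinary
import Summits.BirchSwinnertonDyer.BirchSwinnertonDyer.Theorems.PlecticLegsPlecticPointsLBStubEntireOfAutomorphic
import HarnessLib

/-!
# Line `Sketch` (idea `apex-cone-plectic-invariant`) for crux `PlecticLegs.PlecticPointsLB`
# (stmt-BirchSwinnertonDyer-17518) — lead skeleton, REV 2 (after wave 1), lead `…-17518-a1`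

## What rev 1 was and what wave 1 found

Rev 1 (`Lines/Sketch.lean` @f371dfdca8fc) registered the strategist's ladder verbatim: A `stub_firstZero`,
B `stub_parity`, C `stub_ladder`, D `stub_points`. Wave 1 (three stub-workers + the lead on D, 2026-08-17) returned
`stub-blocked` ×4 with kernel-checked CONDITIONAL proofs (crux tree `Lines/Sketch_stub_*.lean`) and landed the printed
engines as Literature named facts:

* A ⇐ `Literature.NumberTheory.EllipticCurves.Wan2015_theorem7_ellipticCurve` (p164649, ACCEPTED: Wan, Forum Math.
  Sigma 3 (2015) e18, Thm 7, for modular elliptic curves) + modularity of `V/F` (the Langlands-route crux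
  `Summit.Langlands.Langlands.Theses.AdjointEulerNumerical.TotallyRealWeightZeroAutomorphic`, stmt-Langlands-2176: in print
  for `[F:ℚ] ≤ 3` — `FLS2015_theorem1`, `DNS2020_theorem4` — and quartic `F ∌ √5` — `Box2022_theorem1_1`; open beyond)
  + the even-degree/odd-order case of Wan's hypothesis (iii), which is VACUOUS in the plectic regime `r_an = [F:ℚ]`;
* B ⇐ `…Nekovar2013_theoremA` (p164451, ACCEPTED: Nekovář, ANT 7 (2013) Thm A) + `…Deuring1941_nonempty_geomEndRing_
  ringHom_padicInt_of_ordinary` (p164475, ACCEPTED: ordinary above `p` ⇒ `p` splits in the CM field) + the JUNK BRIDGE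
  `analyticRank ≠ 0 → HasEntireLFunction`, a theorem of the tree over `ℚ` only (over `F` the absolute-convergence
  argument fails: conjugate primes above `p` may cancel in `aₙ`; it needs Chebotarev-density input not in the tree);
* C: `k = 1` (rank-one p-converse over totally real `F`) — NO printed theorem located (15 queries, 12 papers; log
  `work/stubs/stub_ladder.md`); `k ≥ 2` OPEN (rank-k p-converse; the ℚ-side frontier `SelmerRank.SelmerRankLB`);
* D ⇐ `Literature.NumberTheory.EllipticCurves.ShaFiniteConjectureNF` (Tate 1974 Conj. 1, EXISTING conjecture decl) +
  an admissible-prime supply (Serre 1972 + Deuring; not in tree) — `Lines/Sketch_stub_points.lean`.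

## Rev 2: the same ladder, with the printed engines made explicit and the junk bridge routed through modularity

Seven registered stubs (≤ stubs_max), composition `PlecticPointsLB_of` sorry-free, concluding the crux BY NAME, whose
only non-stub hypothesis is the TAGGED route item `TotallyRealWeightZeroAutomorphic` (modularity — needed by A anyway):

1. `stub_printedEngines` — LITERATURE DEBT, not mathematics to be found: the conjunction of the three landed named facts
   (Wan 2015 Thm 7; Nekovář 2013 Thm A; Deuring 1941) and one printed fact vendored by wave 2 (p167254,
   `hasEntireLFunction_of_isAutomorphicOfWeightZero`): "a weight-zero automorphic integral model has entire `L`" (Jacquet–Langlands 1970 Thm 11.1 entirety of `L(s, π)` for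
   cuspidal `π` on `GL₂/F` + `L(E_F, s) = L(s − ½, π)` at every place: Carayol 1986 / Taylor 1989 / Jarvis 1997
   local–global compatibility + strong multiplicity one). It is discharged exactly when those facts get `_holds` proofs.
2. `stub_firstZeroPlectic` — A in the parity-matched regime: `Wan → Modularity → (binders) → r_an ≡ d (mod 2) →
   1 ≤ r_an → 1 ≤ s_p`. LANDED p165897 (`Theorems/PlecticLegsPlecticPointsLBStubFirstZeroPlectic.lean`).
3. `stub_parityOrdinary` — B at primes of good ordinary reduction for curves with entire `L`:
   `Nekovář → Deuring → (F, V, p, ordinary clause) → HasEntireLFunction → s_p ≡ r_an (mod 2)`. LANDED p165889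
   (`Theorems/PlecticLegsPlecticPointsLBStubParityOrdinary.lean`).
4. `stub_entireOfAutomorphic` — the junk bridge, routed through modularity instead of absolute convergence:
   `(automorphic ⇒ entire) → Modularity → ∀ F V, V.HasEntireLFunction`. LANDED p165896
   (`Theorems/PlecticLegsPlecticPointsLBStubEntireOfAutomorphic.lean`).
5. `stub_ladderOne` — C₁, the rank-one p-converse over totally real `F` (continuation + guard form). Near print, XL; open
   in tree.
6. `stub_ladderGeTwo` — C_{≥2}, the rank-k p-converse, `k ≥ 2`. OPEN PROBLEM.
7. `stub_points` — D, unchanged (the Selmer-versus-Mordell–Weil wall; `ShaFiniteConjectureNF` + supply).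

So, modulo the tagged modularity item and the literature debt (1), the crux along this line is EXACTLY C₁ ∧ C_{≥2} ∧ D,
and for `[F:ℚ] = 2` exactly D (`plecticSelmerLB_two`), for `[F:ℚ] = 3` exactly C₁ ∧ D.

Disproof.lean (cdisprove c1–c2) honoured as in rev 1: A/B consume `1 ≤ r_an` and the value of `r_an`; D the regime.
Sorries (rev 2b, after the three landings): exactly FOUR — `stub_printedEngines`, `stub_ladderOne`, `stub_ladderGeTwo`,
`stub_points`; stubs 2–4 are now the landed theorems, imported.
-/

set_option linter.dupNamespace false
set_option linter.unusedVariables false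

open NumberField IsDedekindDomain

namespace Summit.BirchSwinnertonDyer.BirchSwinnertonDyer.Cruxes.PlecticPointsLB.Sketch

open Summit.BirchSwinnertonDyer.BirchSwinnertonDyer.Theses.PlecticLegs
open Summit.Langlands.Langlands.Theses.AdjointEulerNumerical (TotallyRealWeightZeroAutomorphic)
open Literature.NumberTheory.EllipticCurves Literature.NumberTheory.Automorphic

/-! ## The seven registered stubs -/

/-- **1 · `stub_printedEngines` — the line's literature debt.** The conjunction of: Wan 2015 Thm 7 for elliptic curves
(`Wan2015_theorem7_ellipticCurve`, landed p164649); Nekovář 2013 Thm A (`Nekovar2013_theoremA`, p164451); Deuring's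
criterion upstairs (`Deuring1941_nonempty_geomEndRing_ringHom_padicInt_of_ordinary`, p164475); and "automorphic of
weight zero ⇒ entire `L`" for integral models over totally real fields
(`Literature.NumberTheory.Automorphic.hasEntireLFunction_of_isAutomorphicOfWeightZero`, landed p167254 by wave 2:
Jacquet–Langlands 1970 Thm 11.1 + Carayol / Taylor local–global compatibility + Serre–Tate; its body is literally the
expanded hypothesis of stub 4). All four are PUBLISHED theorems; none is proved in the tree. Size: XL each (discharge =
formalise the paper). REV 3: fourth conjunct now cited by name. -/
theorem stub_printedEngines :
    Wan2015_theorem7_ellipticCurve ∧ Nekovar2013_theoremA ∧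
      Deuring1941_nonempty_geomEndRing_ringHom_padicInt_of_ordinary ∧
      hasEntireLFunction_of_isAutomorphicOfWeightZero := by
  sorry

/-- **2 · `stub_firstZeroPlectic` — A in the parity-matched regime, from Wan's theorem and modularity.** For `F`
totally real, `V/F` elliptic, `p` admissible (`5 ≤ p`, `p ∤ disc F`, `ρ̄_{V,p}` irreducible, good ordinary above `p`),
if `ord_{s=1} L(V/F,s) ≡ [F:ℚ] (mod 2)` (so Wan's hypothesis (iii) is vacuous) and `1 ≤ ord`, then
`1 ≤ corank_{ℤ_p} Sel_{p^∞}(V/F)` — GIVEN Wan 2015 Thm 7 (named fact) and modularity of elliptic curves over totally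
real fields (the Langlands crux `TotallyRealWeightZeroAutomorphic`). Closable now (worker A, `Lines/Sketch_stub_firstZero.lean`:
`stub_firstZero_plectic_of_wan`). [cite: doi:10.1017/fms.2015.16, Thm 7] -/
theorem stub_firstZeroPlectic :
    Wan2015_theorem7_ellipticCurve → TotallyRealWeightZeroAutomorphic →
    ∀ (F : Type) [Field F] [NumberField F] [NumberField.IsTotallyReal F] (V : WeierstrassCurve F)
      [V.IsElliptic] (p : ℕ) [Fact p.Prime], 5 ≤ p → ¬ ((p : ℤ) ∣ NumberField.discr F) →
      V.HasIrreducibleModPGaloisRep p →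
      (∀ 𝔭 : HeightOneSpectrum (𝓞 F), (p : 𝓞 F) ∈ 𝔭.asIdeal →
        ((V.baseChange (𝔭.adicCompletion F)).localPolynomial (𝔭.adicCompletionIntegers F)).natDegree = 2 ∧
        ¬ (p : ℤ) ∣ ((V.baseChange (𝔭.adicCompletion F)).localPolynomial
          (𝔭.adicCompletionIntegers F)).coeff 1) →
      V.analyticRank % 2 = Module.finrank ℚ F % 2 → 1 ≤ V.analyticRank → 1 ≤ V.selmerCorank p :=
  Summit.BirchSwinnertonDyer.BirchSwinnertonDyer.Theorems.stub_firstZeroPlectic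

/-- **3 · `stub_parityOrdinary` — B at primes of good ordinary reduction, from Nekovář's Theorem A and Deuring's
criterion.** For `F` totally real, `V/F` elliptic with ENTIRE `L`-function and a prime `p` above which `V` has good
ordinary reduction everywhere, `corank_{ℤ_p} Sel_{p^∞}(V/F) ≡ ord_{s=1} L(V/F,s) (mod 2)` — GIVEN Nekovář 2013 Thm A and
Deuring 1941 (named facts): non-CM curves are case (1) of Theorem A, CM curves case (3) since ordinarity above `p`
splits `p` in the CM field. Closable now (worker B, `Lines/Sketch_stub_parity.lean`:
`selmerCorank_mod_two_eq_analyticRank_of_ordinary`). [cite: doi:10.2140/ant.2013.7.1101, Thm A] -/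
theorem stub_parityOrdinary :
    Nekovar2013_theoremA → Deuring1941_nonempty_geomEndRing_ringHom_padicInt_of_ordinary →
    ∀ (F : Type) [Field F] [NumberField F] [NumberField.IsTotallyReal F] (V : WeierstrassCurve F)
      [V.IsElliptic] (p : ℕ) [Fact p.Prime],
      (∀ 𝔭 : HeightOneSpectrum (𝓞 F), (p : 𝓞 F) ∈ 𝔭.asIdeal →
        ((V.baseChange (𝔭.adicCompletion F)).localPolynomial (𝔭.adicCompletionIntegers F)).natDegree = 2 ∧
        ¬ (p : ℤ) ∣ ((V.baseChange (𝔭.adicCompletion F)).localPolynomial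
          (𝔭.adicCompletionIntegers F)).coeff 1) →
      V.HasEntireLFunction → V.selmerCorank p % 2 = V.analyticRank % 2 :=
  Summit.BirchSwinnertonDyer.BirchSwinnertonDyer.Theorems.stub_parityOrdinary

/-- **4 · `stub_entireOfAutomorphic` — the junk bridge through modularity.** If weight-zero automorphic integral models
have entire `L` (Jacquet–Langlands + local–global compatibility, stated expanded as in stub 1) and every integral model
with `Δ ≠ 0` over every totally real field is automorphic of weight zero (`TotallyRealWeightZeroAutomorphic`), then
every elliptic curve over a totally real field has an entire `L`-function — so its `analyticRank` is the honest order of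
vanishing (no junk branch). Closable now: integral model up to `F`-isomorphism
(`WeierstrassCurve.exists_variableChange_smul_baseChange_eq`) and isomorphism invariance
(`WeierstrassCurve.hasEntireLFunction_smul_iff`). [folklore] -/
theorem stub_entireOfAutomorphic :
    (∀ (F : Type) [Field F] [NumberField F] [NumberField.IsTotallyReal F] (E : WeierstrassCurve (𝓞 F)),
        E.Δ ≠ 0 → IsAutomorphicOfWeightZero E → (E.baseChange F).HasEntireLFunction) →
    TotallyRealWeightZeroAutomorphic →
    ∀ (F : Type) [Field F] [NumberField F] [NumberField.IsTotallyReal F] (V : WeierstrassCurve F)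
      [V.IsElliptic], V.HasEntireLFunction :=
  Summit.BirchSwinnertonDyer.BirchSwinnertonDyer.Theorems.stub_entireOfAutomorphic

/-- **5 · `stub_ladderOne` — C₁, the rank-one `p`-converse over a totally real field.** For `F` totally real of degree
`≥ 3`, `V/F` elliptic with entire `L`, `p` admissible: `1 ≤ ord_{s=1} L(V/F,s)` and `corank_{ℤ_p} Sel_{p^∞}(V/F) = 1`
imply `ord = 1`. Over `ℚ` a theorem (Skinner 2020; W. Zhang 2014; Burungale–Skinner–Tian–Wan); over totally real `F`
the ingredients exist (Liu–Zhang–Zhang 2018, Wan 2015, Longo 2012 / Fouquet 2013, Yuan–Zhang–Zhang, Nekovář) but NO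
stated theorem was located (wave 1, `work/stubs/stub_ladder.md`: nearest arXiv:2504.21799, real quadratic +
split multiplicative). Why it might fail as typed: only through a mismatch of Selmer conventions; true iff
`p^∞`-Selmer BSD holds in corank 1. Size XL. [cite: doi:10.4007/annals.2020.191.2.1, Thm A (the ℚ case)] -/
theorem stub_ladderOne :
    ∀ (F : Type) [Field F] [NumberField F] [NumberField.IsTotallyReal F] (V : WeierstrassCurve F)
      [V.IsElliptic] (p : ℕ) [Fact p.Prime], 5 ≤ p → ¬ ((p : ℤ) ∣ NumberField.discr F) →
      V.HasIrreducibleModPGaloisRep p →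
      (∀ 𝔭 : HeightOneSpectrum (𝓞 F), (p : 𝓞 F) ∈ 𝔭.asIdeal →
        ((V.baseChange (𝔭.adicCompletion F)).localPolynomial (𝔭.adicCompletionIntegers F)).natDegree = 2 ∧
        ¬ (p : ℤ) ∣ ((V.baseChange (𝔭.adicCompletion F)).localPolynomial
          (𝔭.adicCompletionIntegers F)).coeff 1) →
      3 ≤ Module.finrank ℚ F → V.HasEntireLFunction → 1 ≤ V.analyticRank →
        V.selmerCorank p = 1 → V.analyticRank = 1 := by
  sorry

/-- **6 · `stub_ladderGeTwo` — C_{≥2}, the rank-`k` `p`-converse in coranks `2 ≤ k ≤ [F:ℚ] − 2`.** Same binders, entire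
`L`, `1 ≤ ord`: `corank_{ℤ_p} Sel_{p^∞}(V/F) = k ⇒ ord_{s=1} L(V/F,s) = k`. OPEN PROBLEM (needed from `[F:ℚ] = 4` on):
no Euler/Kolyvagin system certifies "corank exactly `k` ⇒ order exactly `k`" for `k ≥ 2` (generalised Kato classes
give only "class ≠ 0 ⇒ dim Sel = 2", Castella–Hsieh 2022); it is `p^∞`-Selmer BSD in those coranks; the same frontier
as the ℚ-side `SelmerRank.SelmerRankLB` ("LB open from `r_an = 4`"). The apex-cone card proposes Hsieh's
`d`-variable measure at its apex as the engine here (untyped). Size: open-problem. -/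
theorem stub_ladderGeTwo :
    ∀ (F : Type) [Field F] [NumberField F] [NumberField.IsTotallyReal F] (V : WeierstrassCurve F)
      [V.IsElliptic] (p : ℕ) [Fact p.Prime], 5 ≤ p → ¬ ((p : ℤ) ∣ NumberField.discr F) →
      V.HasIrreducibleModPGaloisRep p →
      (∀ 𝔭 : HeightOneSpectrum (𝓞 F), (p : 𝓞 F) ∈ 𝔭.asIdeal →
        ((V.baseChange (𝔭.adicCompletion F)).localPolynomial (𝔭.adicCompletionIntegers F)).natDegree = 2 ∧
        ¬ (p : ℤ) ∣ ((V.baseChange (𝔭.adicCompletion F)).localPolynomial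
          (𝔭.adicCompletionIntegers F)).coeff 1) →
      ∀ k : ℕ, 2 ≤ k → k + 2 ≤ Module.finrank ℚ F → V.HasEntireLFunction → 1 ≤ V.analyticRank →
        V.selmerCorank p = k → V.analyticRank = k := by
  sorry

/-- **7 · `stub_points` — D, Selmer corank realised by points at ONE admissible prime (Ш[p^∞]-cotorsion in the
plectic regime).** Unchanged from rev 1 / `Lines/selmer_ladder.lean`: for `F` totally real of degree `d ≥ 2` and `V/F`
elliptic with `ord_{s=1} L(V/F,s) = d`, there is an admissible `p` with `corank_{ℤ_p} Sel_{p^∞}(V/F) ≤ rank_ℤ V(F)`.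
Reductions (lead, `Lines/Sketch_stub_points.lean`, sorry-free): D ⇐ `ShaFiniteConjectureNF` over totally real fields +
an admissible-prime supply; D ⇐ `corank Ш(V/F)[p^∞] = 0` at one admissible prime in the regime. The
Selmer-versus-Mordell–Weil WALL (`Literature.Barriers.BirchSwinnertonDyer.SelmerRankBarrier`, narrow form); open for every
curve of analytic rank `≥ 2` over every number field. Size: open-problem. [cite: arXiv:2310.16758, Conj. 3.10] -/
theorem stub_points :
    ∀ (F : Type) [Field F] [NumberField F] [NumberField.IsTotallyReal F] (V : WeierstrassCurve F)
      [V.IsElliptic], 2 ≤ Module.finrank ℚ F → V.analyticRank = Module.finrank ℚ F →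
      ∃ (p : ℕ) (_ : Fact p.Prime), 5 ≤ p ∧ ¬ ((p : ℤ) ∣ NumberField.discr F) ∧
        V.HasIrreducibleModPGaloisRep p ∧
        (∀ 𝔭 : HeightOneSpectrum (𝓞 F), (p : 𝓞 F) ∈ 𝔭.asIdeal →
          ((V.baseChange (𝔭.adicCompletion F)).localPolynomial (𝔭.adicCompletionIntegers F)).natDegree = 2 ∧
          ¬ (p : ℤ) ∣ ((V.baseChange (𝔭.adicCompletion F)).localPolynomial
            (𝔭.adicCompletionIntegers F)).coeff 1) ∧
        V.selmerCorank p ≤ V.mordellWeilRank := by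
  sorry

/-! ## Stub statements by name -/

namespace Statement

/-- Statement of `stub_printedEngines`. -/
abbrev stub_printedEngines : Prop := type_of% @Sketch.stub_printedEngines
/-- Statement of `stub_firstZeroPlectic`. -/
abbrev stub_firstZeroPlectic : Prop := type_of% @Sketch.stub_firstZeroPlectic
/-- Statement of `stub_parityOrdinary`. -/
abbrev stub_parityOrdinary : Prop := type_of% @Sketch.stub_parityOrdinary
/-- Statement of `stub_entireOfAutomorphic`. -/
abbrev stub_entireOfAutomorphic : Prop := type_of% @Sketch.stub_entireOfAutomorphic
/-- Statement of `stub_ladderOne`. -/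
abbrev stub_ladderOne : Prop := type_of% @Sketch.stub_ladderOne
/-- Statement of `stub_ladderGeTwo`. -/
abbrev stub_ladderGeTwo : Prop := type_of% @Sketch.stub_ladderGeTwo
/-- Statement of `stub_points`. -/
abbrev stub_points : Prop := type_of% @Sketch.stub_points

end Statement

/-! ## The Selmer-level target and the compositions (sorry-free) -/

/-- **`PlecticSelmerLB`** — the Selmer-level lower bound in the plectic regime (unchanged from rev 1): `F` totally real
of degree `d ≥ 2`, `V/F` elliptic with `ord_{s=1} L(V/F,s) = d`, `p` admissible ⇒ `d ≤ corank_{ℤ_p} Sel_{p^∞}(V/F)`.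
NECESSARY for the crux (`SketchTightness.lean`: `plecticSelmerLB_of_plecticPointsLB`). -/
def PlecticSelmerLB : Prop :=
  ∀ (F : Type) [Field F] [NumberField F] [NumberField.IsTotallyReal F] (V : WeierstrassCurve F)
    [V.IsElliptic] (p : ℕ) [Fact p.Prime], 5 ≤ p → ¬ ((p : ℤ) ∣ NumberField.discr F) →
    V.HasIrreducibleModPGaloisRep p →
    (∀ 𝔭 : HeightOneSpectrum (𝓞 F), (p : 𝓞 F) ∈ 𝔭.asIdeal →
      ((V.baseChange (𝔭.adicCompletion F)).localPolynomial (𝔭.adicCompletionIntegers F)).natDegree = 2 ∧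
      ¬ (p : ℤ) ∣ ((V.baseChange (𝔭.adicCompletion F)).localPolynomial
        (𝔭.adicCompletionIntegers F)).coeff 1) →
    2 ≤ Module.finrank ℚ F → V.analyticRank = Module.finrank ℚ F →
    Module.finrank ℚ F ≤ V.selmerCorank p

/-- **The ladder, rev 2**: modularity + literature debt + A + B + bridge + C₁ + C_{≥2} ⇒ `PlecticSelmerLB`. Given an
admissible `p` and `r_an = d ≥ 2`: `L` is entire (4); A gives `1 ≤ s_p` (parity matched since `r_an = d`); B gives
`s_p ≡ d (mod 2)`; if `s_p < d`: `s_p = 1` forces `d ≥ 3` (parity) and then C₁ gives `r_an = 1 ≠ d`; `2 ≤ s_p ≤ d − 2`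
gives `r_an = s_p < d` by C_{≥2}; `s_p = d − 1` breaks parity. -/
theorem plecticSelmerLB_of_ladder (hMod : TotallyRealWeightZeroAutomorphic) (hLit : Statement.stub_printedEngines)
    (hA : Statement.stub_firstZeroPlectic) (hB : Statement.stub_parityOrdinary)
    (hE : Statement.stub_entireOfAutomorphic) (hC1 : Statement.stub_ladderOne)
    (hC2 : Statement.stub_ladderGeTwo) : PlecticSelmerLB := by
  intro F _ _ _ V _ p _ h5 hdisc hirr hord hd hran
  obtain ⟨hW, hN, hDe, hJL⟩ := hLit
  have hL : V.HasEntireLFunction := hE hJL hMod F V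
  have hpos : 1 ≤ V.analyticRank := by omega
  have hpar : V.analyticRank % 2 = Module.finrank ℚ F % 2 := by rw [hran]
  have h1 : 1 ≤ V.selmerCorank p := hA hW hMod F V p h5 hdisc hirr hord hpar hpos
  have h2 : V.selmerCorank p % 2 = V.analyticRank % 2 := hB hN hDe F V p hord hL
  by_contra hlt
  push Not at hlt
  rw [hran] at h2
  by_cases hs1 : V.selmerCorank p = 1
  · -- then d ≥ 3 by parity, and C₁ gives r_an = 1 < d
    have hd3 : 3 ≤ Module.finrank ℚ F := by omega
    have := hC1 F V p h5 hdisc hirr hord hd3 hL hpos hs1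
    omega
  · by_cases hsd : V.selmerCorank p + 2 ≤ Module.finrank ℚ F
    · have := hC2 F V p h5 hdisc hirr hord (V.selmerCorank p) (by omega) hsd hL hpos rfl
      omega
    · -- s_p = d - 1: parity contradiction
      have hc : V.selmerCorank p = Module.finrank ℚ F - 1 := by omega
      rw [hc] at h2
      omega

/-- **`[F:ℚ] = 2` needs neither p-converse**: modularity + debt + A + B + bridge give `PlecticSelmerLB` for real
quadratic `F` (`1 ≤ s_p`, `s_p` even ⇒ `2 ≤ s_p`). (Modularity in degree 2 is the printed `FLS2015_theorem1`; the
hypothesis here is the all-degree item only because stubs 2 and 4 are stated with it.) -/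
theorem plecticSelmerLB_two (hMod : TotallyRealWeightZeroAutomorphic) (hLit : Statement.stub_printedEngines)
    (hA : Statement.stub_firstZeroPlectic) (hB : Statement.stub_parityOrdinary)
    (hE : Statement.stub_entireOfAutomorphic) :
    ∀ (F : Type) [Field F] [NumberField F] [NumberField.IsTotallyReal F] (V : WeierstrassCurve F)
      [V.IsElliptic] (p : ℕ) [Fact p.Prime], 5 ≤ p → ¬ ((p : ℤ) ∣ NumberField.discr F) →
      V.HasIrreducibleModPGaloisRep p →
      (∀ 𝔭 : HeightOneSpectrum (𝓞 F), (p : 𝓞 F) ∈ 𝔭.asIdeal →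
        ((V.baseChange (𝔭.adicCompletion F)).localPolynomial (𝔭.adicCompletionIntegers F)).natDegree = 2 ∧
        ¬ (p : ℤ) ∣ ((V.baseChange (𝔭.adicCompletion F)).localPolynomial
          (𝔭.adicCompletionIntegers F)).coeff 1) →
      Module.finrank ℚ F = 2 → V.analyticRank = 2 → 2 ≤ V.selmerCorank p := by
  intro F _ _ _ V _ p _ h5 hdisc hirr hord hd hran
  obtain ⟨hW, hN, hDe, hJL⟩ := hLit
  have hL : V.HasEntireLFunction := hE hJL hMod F V
  have hpos : 1 ≤ V.analyticRank := by omega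
  have hpar : V.analyticRank % 2 = Module.finrank ℚ F % 2 := by rw [hran, hd]
  have h1 : 1 ≤ V.selmerCorank p := hA hW hMod F V p h5 hdisc hirr hord hpar hpos
  have h2 : V.selmerCorank p % 2 = V.analyticRank % 2 := hB hN hDe F V p hord hL
  omega

/-- **`[F:ℚ] = 3` needs only C₁**: modularity + debt + A + B + bridge + C₁ give `PlecticSelmerLB` for totally real
cubic `F`. -/
theorem plecticSelmerLB_three (hMod : TotallyRealWeightZeroAutomorphic) (hLit : Statement.stub_printedEngines)
    (hA : Statement.stub_firstZeroPlectic) (hB : Statement.stub_parityOrdinary)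
    (hE : Statement.stub_entireOfAutomorphic) (hC1 : Statement.stub_ladderOne) :
    ∀ (F : Type) [Field F] [NumberField F] [NumberField.IsTotallyReal F] (V : WeierstrassCurve F)
      [V.IsElliptic] (p : ℕ) [Fact p.Prime], 5 ≤ p → ¬ ((p : ℤ) ∣ NumberField.discr F) →
      V.HasIrreducibleModPGaloisRep p →
      (∀ 𝔭 : HeightOneSpectrum (𝓞 F), (p : 𝓞 F) ∈ 𝔭.asIdeal →
        ((V.baseChange (𝔭.adicCompletion F)).localPolynomial (𝔭.adicCompletionIntegers F)).natDegree = 2 ∧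
        ¬ (p : ℤ) ∣ ((V.baseChange (𝔭.adicCompletion F)).localPolynomial
          (𝔭.adicCompletionIntegers F)).coeff 1) →
      Module.finrank ℚ F = 3 → V.analyticRank = 3 → 3 ≤ V.selmerCorank p := by
  intro F _ _ _ V _ p _ h5 hdisc hirr hord hd hran
  obtain ⟨hW, hN, hDe, hJL⟩ := hLit
  have hL : V.HasEntireLFunction := hE hJL hMod F V
  have hpos : 1 ≤ V.analyticRank := by omega
  have hpar : V.analyticRank % 2 = Module.finrank ℚ F % 2 := by rw [hran, hd]
  have h1 : 1 ≤ V.selmerCorank p := hA hW hMod F V p h5 hdisc hirr hord hpar hpos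
  have h2 : V.selmerCorank p % 2 = V.analyticRank % 2 := hB hN hDe F V p hord hL
  by_contra hlt
  have hs1 : V.selmerCorank p = 1 := by omega
  have := hC1 F V p h5 hdisc hirr hord (by omega) hL hpos hs1
  omega

/-- **`PlecticPointsLB_of`** — the seven stub STATEMENTS and the tagged modularity item imply the crux
`PlecticLegs.PlecticPointsLB`, BY NAME: D supplies an admissible `p` with `s_p ≤ rank`, the ladder gives `d ≤ s_p`.
Axioms: propext, Classical.choice, Quot.sound. (Both theorems of this file concluding the crux —
this one and `PlecticPointsLB_proof` — have only stub / tagged hypotheses.) -/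
theorem PlecticPointsLB_of (hMod : TotallyRealWeightZeroAutomorphic) (hLit : Statement.stub_printedEngines)
    (hA : Statement.stub_firstZeroPlectic) (hB : Statement.stub_parityOrdinary)
    (hE : Statement.stub_entireOfAutomorphic) (hC1 : Statement.stub_ladderOne)
    (hC2 : Statement.stub_ladderGeTwo) (hD : Statement.stub_points) : PlecticPointsLB := by
  intro F _ _ _ V _ hd hran
  obtain ⟨p, hp, h5, hdisc, hirr, hord, hpts⟩ := hD F V hd hran
  haveI := hp
  exact (plecticSelmerLB_of_ladder hMod hLit hA hB hE hC1 hC2 F V p h5 hdisc hirr hord hd hran).trans hpts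

/-- The crux along this line, MODULO the seven registered stubs, under the tagged modularity item
(`TotallyRealWeightZeroAutomorphic`, Langlands-route crux stmt-Langlands-2176 — a hypothesis, not a stub of this line). -/
theorem PlecticPointsLB_proof (hMod : TotallyRealWeightZeroAutomorphic) : PlecticPointsLB :=
  PlecticPointsLB_of hMod stub_printedEngines stub_firstZeroPlectic stub_parityOrdinary
    stub_entireOfAutomorphic stub_ladderOne stub_ladderGeTwo stub_points

end Summit.BirchSwinnertonDyer.BirchSwinnertonDyer.Cruxes.PlecticPointsLB.Sketch
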